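import Mathlib
import Summits.NavierStokesRegularity.NavierStokesRegularity.Theorems.TypeIQuarterGateScarEnvelopeTypeISatelliteTowerHullBirkhoff

/-!
# Satellite tower for crux `ScarEnvelopeTypeI` (stmt-NavierStokesRegularity-23843) — ROUND-45 Part C: ORBIT ISOLATION converts recurrence into self-similarity (Z14 ★★ isolation + recurrence ⇒ exact past-DSS; Z14′ the DSS-free enemy is never orbit-isolated; Z15 ★ 23843 ⟸ (τ) ∧ (κ) ∧ (υ))

Part C of nsreg-p3 g28's ROUND-45 artefact (landing form (25c)): `ae_nsRescale_div_of_ae_eq` (a.e. group law on the slab, via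
`rlNearIdentityDSS_ae_comp_dilation`); Z14 ★★ `ABTower.exists_pastDss_of_recurrent_of_orbitIsolated` (uniform recurrence + ORBIT ISOLATION ⇒ exactly
past-DSS with a factor `> 1`); Z14′ `ABTower.not_orbitIsolated_of_recurrent_of_dssFree`; Z15 ★ `scarEnvelopeTypeI_of_dssCells_of_orbitIsolation`
(23843 ⟸ (τ) ∧ (κ) ∧ (υ); audit `proof.conditional`).  HONEST STATUS (artefact header): restricted to past-DSS-free uniformly recurrent objects (υ) can
only hold vacuously (Z14′), so as a hypothesis it is EQUIVALENT to the bare exclusion (θ′) — not a weakening; the content is the METRIC READING of the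
(θ′)-enemy (a recurrent scaling orbit with NON-ISOLATED ε-returns, never exact) and the form (Z14) in which an NS-specific ε-rigidity input would convert
the recurrent cell into the DSS cells.  CONDITIONAL statements credit nothing; item 23843 is OPEN.

PROVENANCE: declaration texts VERBATIM from the HOME artefact of the instrument seat nsreg-p3 g28 (cell `pub/ns-regularity-ideate`):
`round-45/Birkhoff45.lean` (sha16 `f8170ff5aabdcd25`, parts `partA45…partD45.lean`; a module written against the TREE, importing route
RecurrentProfiles' crux-1589 dynamics modules and the Literature dynamics BY NAME; its Part Z = ROUND-44 is already in the tree as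
`…SatelliteTowerHullJunction/…HullDichotomy/…DssNecklace/…DssCell/…HullCells/…HullEdge`, p664756…p666018), scored by referee ref3
(`SCORE-p3-ROUND-45-0828.md` cba78f676c9340cc, PASS TEXT+LEAN ★★ 21:02:16Z); the author cannot write under `Theorems/` (`perm.theorems-prover-only`); landed by the prover
ns-es-p1 g6 as landing hand of record (director-ns DIRECTOR-NS #237 (3)), split into ≤ 400-line modules, the artefact's
`#guard_msgs … #print axioms` certificates not landed.  `--supports stmt-NavierStokesRegularity-23843 --as helper`.

HONEST FRAMING: NORMAL FORM / JUNCTION / MECHANISM / METER theorems about HYPOTHETICAL Type-I zoom limits (Albritton–Barker objects of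
the census of crux `TypeIQuarterGate.ScarEnvelopeTypeI`, item 23843).  Movement 0 on anything open: item 23843, route TypeIQuarterGate,
crux 1589 `RecurrentLiouville`, crux 22144 `FiniteDissipationLiouville`, the statements (ρ), (θ′), (υ), the DSS cells (τ), (κ), N0 and
Navier–Stokes regularity are all OPEN — NS regularity is NOT proved here.  IN-TREE DISCLOSURE (cited by name, not re-derived):
Furstenberg 1981 Thms 1.15/1.17 (`Literature/Dynamics/TopologicalDynamics/{UniformRecurrence,MinimalOrbitClosure}.lean`), the `L³_loc`
slab-field model `SlabField` (`Literature/Analysis/FluidPDE/ScalingRecurrentSlabField.lean`), `exists_orbit_limit` (Albritton–Barker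
compactness), `stub_prJointContinuity`, `rlNearIdentityDSS_ae_comp_dilation` (route RecurrentProfiles / SqueezeCycle lineage), the PROVED
tree theorem `pineauVicol2026_oneSlice_regularity_holds` (Pineau–Vicol 2026 Thm 1.9) and the KNSS pressure package
`ChiralWindowDoorClassDerivDecay.exists_classical_scaleInvariantBounds_of_class`.  The same two moves exist EARLIER in crux 22144's
lineage (`FiniteDissipationLiouville.…HullCategoryMinimal.recurrent_of_orbitLimit`, `…Envelope.pv_unsteadiness_floor_of_minimal`) for a
different class; here they are proved independently for the Albritton–Barker class — NOT a new mechanism.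
-/

-- the summit-side namespace repeats a component by design (single-conjunct summit, D-0017)
set_option linter.dupNamespace false

open MeasureTheory Set Metric Filter Topology
open scoped ENNReal NNReal InnerProductSpace
open Literature.Analysis.FluidPDE
open Literature.Dynamics.TopologicalDynamics

namespace Summit.NavierStokesRegularity.NavierStokesRegularity.Cruxes.ScarEnvelopeTypeI.ZoomDictionary

section HullJunction

variable {U U₁ U₂ W : ℝ → (EuclideanSpace ℝ (Fin 3)) → (EuclideanSpace ℝ (Fin 3))}
  {P : ℝ → (EuclideanSpace ℝ (Fin 3)) → ℝ}
  {H : ℝ → (EuclideanSpace ℝ (Fin 3)) → (EuclideanSpace ℝ (Fin 3)) →L[ℝ] (EuclideanSpace ℝ (Fin 3))}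
  {M : ℝ}

/-! ## ROUND 45 — Part C.  ORBIT ISOLATION CONVERTS RECURRENCE INTO SELF-SIMILARITY
(an exclusion MECHANISM for the DSS-free cell: local uniqueness modulo scaling ⇒ the enemy is DSS).

If a uniformly recurrent A–B object `U` is ORBIT-ISOLATED — every far return `U_{e^σ}`, `σ ≥ δ`, which is
`ε`-close to `U` in `L³(K)` is ALMOST EVERYWHERE an honest small rescaling `U_c`, `e^{-δ} < c < e^{δ}` — then one
far return (uniform recurrence supplies them in every window) gives `U_{e^σ/c} = U` on the past with
`e^σ/c > 1`: `U` is exactly past-DSS.  So in the DSS-free cell (θ′) the enemy is NEVER orbit-isolated (Z14′), and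
23843 ⟸ (τ) ∧ (κ) ∧ (υ) with (υ) = orbit isolation of DSS-free uniformly recurrent doubly-minimal rooted objects
(Z15) — a LOCAL-UNIQUENESS-MODULO-SCALING statement, different in kind from a Liouville theorem.

LOGICAL STATUS (honest): restricted to past-DSS-free uniformly recurrent objects, orbit isolation can only hold
VACUOUSLY (Z14′), so (υ) as a hypothesis is EQUIVALENT to the bare exclusion «no past-DSS-free uniformly recurrent
doubly-minimal rooted object» ((θ′) of Part B without its hull clause) — it is NOT a weakening.  What Part C adds
is the METRIC READING of the enemy, kernel-checked: the (θ′)-enemy is exactly a recurrent orbit of the scaling flow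
with NON-ISOLATED returns — on every compact past window and beyond every scaling time it returns `ε`-close to
itself in `L³` WITHOUT ever returning exactly (almost periodic, never periodic: the Morse–Thue picture of ref3
R43-F3 made quantitative); and Z14 is the form in which an NS-specific `ε`-RIGIDITY input («two such objects
`ε`-close on a window and … coincide modulo scaling») would convert the recurrent cell into the DSS cells. -/

/-- a.e. group law on the slab: `U_a = U_b` a.e. (`a, b > 0`) ⇒ `U_{a/b} = U` a.e. (transport of the identity along
the dilation by `b⁻¹`, `rlNearIdentityDSS_ae_comp_dilation`, and `nsRescale_mul`). -/
theorem ae_nsRescale_div_of_ae_eq {a b : ℝ} (_ha : 0 < a) (hb : 0 < b)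
    (h : ∀ᵐ z ∂(volume.restrict (Iio (0 : ℝ) ×ˢ (univ : Set (EuclideanSpace ℝ (Fin 3))))),
      nsRescale a U z.1 z.2 = nsRescale b U z.1 z.2) :
    ∀ᵐ z ∂(volume.restrict (Iio (0 : ℝ) ×ˢ (univ : Set (EuclideanSpace ℝ (Fin 3))))),
      nsRescale (a / b) U z.1 z.2 = U z.1 z.2 := by
  have h1 := Summit.NavierStokesRegularity.NavierStokesRegularity.Theorems.rlNearIdentityDSS_ae_comp_dilation
    (F := fun z => nsRescale a U z.1 z.2) (G := fun z => nsRescale b U z.1 z.2) (c := b⁻¹) (inv_pos.2 hb) h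
  filter_upwards [h1] with z hz
  have e1 : nsRescale (a / b) U z.1 z.2 = b⁻¹ • nsRescale a U ((b⁻¹) ^ 2 * z.1) (b⁻¹ • z.2) := by
    rw [div_eq_mul_inv, nsRescale_mul, nsRescale_apply]
  have e2 : U z.1 z.2 = b⁻¹ • nsRescale b U ((b⁻¹) ^ 2 * z.1) (b⁻¹ • z.2) := by
    have h2 := congrArg (fun f => f z.1 z.2) (nsRescale_mul b b⁻¹ U)
    rw [mul_inv_cancel₀ hb.ne', nsRescale_one] at h2
    rw [h2, nsRescale_apply]
  rw [e1, e2]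
  exact congrArg _ hz

/-- ★★ **Z14.  ORBIT ISOLATION + RECURRENCE ⇒ EXACT PAST-DSS.**  Let `U` be an A–B object, uniformly recurrent under
scaling, and ORBIT-ISOLATED at some scale `(ε, K, δ)`: every return `U_{e^σ}` with `σ ≥ δ` that is `ε`-close to `U`
in `L³(K)` coincides a.e. on the slab with a SMALL rescaling `U_c`, `e^{-δ} < c < e^{δ}`.  Then `U` is exactly
past-DSS with some factor `μ > 1` (namely `μ = e^σ/c` for the first far return in the window `[δ+1, δ+1+L]`). -/
theorem ABTower.exists_pastDss_of_recurrent_of_orbitIsolated (hT : ABTower M U P H)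
    (hrec : IsScalingUniformlyRecurrent U)
    {ε : ℝ} (hε : 0 < ε) {K : Set (ℝ × (EuclideanSpace ℝ (Fin 3)))} (hK : IsCompact K)
    (hKH : K ⊆ Iic (0 : ℝ) ×ˢ (univ : Set (EuclideanSpace ℝ (Fin 3)))) {δ : ℝ} (_hδ : 0 < δ)
    (hiso : ∀ σ : ℝ, δ ≤ σ →
      eLpNorm (fun z : ℝ × (EuclideanSpace ℝ (Fin 3)) => nsRescale (Real.exp σ) U z.1 z.2 - U z.1 z.2) 3
        (volume.restrict K) ≤ ENNReal.ofReal ε →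
      ∃ c : ℝ, Real.exp (-δ) < c ∧ c < Real.exp δ ∧
        ∀ᵐ z ∂(volume.restrict (Iio (0 : ℝ) ×ˢ (univ : Set (EuclideanSpace ℝ (Fin 3))))),
          nsRescale (Real.exp σ) U z.1 z.2 = nsRescale c U z.1 z.2) :
    ∃ μ : ℝ, 1 < μ ∧ ∀ t < 0, ∀ x, nsRescale μ U t x = U t x := by
  obtain ⟨L, _hL, hwin⟩ := hrec ε hε K hK hKH
  obtain ⟨σ, hσ, hret⟩ := hwin (δ + 1)
  have hσδ : δ ≤ σ := by linarith [hσ.1]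
  obtain ⟨c, hc1, hc2, hae⟩ := hiso σ hσδ hret
  have hc : 0 < c := (Real.exp_pos _).trans hc1
  have hμ : 0 < Real.exp σ / c := div_pos (Real.exp_pos σ) hc
  refine ⟨Real.exp σ / c, ?_, ?_⟩
  · rw [lt_div_iff₀ hc, one_mul]
    exact hc2.trans_le (Real.exp_le_exp.2 hσδ)
  · exact hT.pastDss_of_ae (W := U) hμ (ae_of_all _ fun _ => rfl)
      (ae_nsRescale_div_of_ae_eq (Real.exp_pos σ) hc hae)

/-- **Z14′.  In the DSS-free cell the enemy is never orbit-isolated**: a past-DSS-free, uniformly recurrent A–B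
object returns `ε`-close to itself at arbitrarily large scale separations WITHOUT coinciding with a small
rescaling of itself — at every scale `(ε, K, δ)`. -/
theorem ABTower.not_orbitIsolated_of_recurrent_of_dssFree (hT : ABTower M U P H)
    (hrec : IsScalingUniformlyRecurrent U)
    (hfree : ∀ c : ℝ, 0 < c → (∀ t < 0, ∀ x, nsRescale c U t x = U t x) → c = 1)
    {ε : ℝ} (hε : 0 < ε) {K : Set (ℝ × (EuclideanSpace ℝ (Fin 3)))} (hK : IsCompact K)
    (hKH : K ⊆ Iic (0 : ℝ) ×ˢ (univ : Set (EuclideanSpace ℝ (Fin 3)))) {δ : ℝ} (hδ : 0 < δ) :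
    ∃ σ : ℝ, δ ≤ σ ∧
      eLpNorm (fun z : ℝ × (EuclideanSpace ℝ (Fin 3)) => nsRescale (Real.exp σ) U z.1 z.2 - U z.1 z.2) 3
        (volume.restrict K) ≤ ENNReal.ofReal ε ∧
      ∀ c : ℝ, Real.exp (-δ) < c → c < Real.exp δ →
        ¬ (∀ᵐ z ∂(volume.restrict (Iio (0 : ℝ) ×ˢ (univ : Set (EuclideanSpace ℝ (Fin 3))))),
          nsRescale (Real.exp σ) U z.1 z.2 = nsRescale c U z.1 z.2) := by
  by_contra hcon
  obtain ⟨μ, hμ, hd⟩ := hT.exists_pastDss_of_recurrent_of_orbitIsolated hrec hε hK hKH hδ (by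
    intro σ hσ hret
    by_contra hc'
    exact hcon ⟨σ, hσ, hret, fun c hc1 hc2 hae => hc' ⟨c, hc1, hc2, hae⟩⟩)
  have h1 := hfree μ (one_pos.trans hμ) hd
  linarith

/-- ★★ **Z15.  23843 ⟸ (τ) ∧ (κ) ∧ (υ): the two DSS cells and ORBIT ISOLATION.**  If, besides the exclusion of the
two DSS cells of Z13, every past-DSS-free uniformly recurrent doubly-minimal rooted census object is orbit-isolated
at SOME scale `(ε, K, δ)` — a local-uniqueness-modulo-scaling property of these maximally rigid objects — then
23843 holds: by Z14 such an object would be exactly past-DSS, contradicting past-DSS-freeness.  (By Z14′ the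
hypothesis `hυ` is equivalent to the plain non-existence of such objects; see the Part C header: (υ) is the
METRIC form of (θ′), not a weaker statement.) -/
theorem scarEnvelopeTypeI_of_dssCells_of_orbitIsolation
    (hτ : ∀ (I₀ : ℝ≥0∞) (U : ℝ → (EuclideanSpace ℝ (Fin 3)) → (EuclideanSpace ℝ (Fin 3)))
      (P : ℝ → (EuclideanSpace ℝ (Fin 3)) → ℝ)
      (H : ℝ → (EuclideanSpace ℝ (Fin 3)) → (EuclideanSpace ℝ (Fin 3)) →L[ℝ] (EuclideanSpace ℝ (Fin 3)))
      (lam0 A : ℝ), (∀ y : (EuclideanSpace ℝ (Fin 3)), DoublyMin I₀ ⟨U, P, H, y⟩) → ¬ RegPt U 0 → 1 < lam0 →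
      (∀ t < 0, ∀ x, nsRescale lam0 U t x = U t x) →
      (∀ c : ℝ, 0 < c → ((∀ t < 0, ∀ x, nsRescale c U t x = U t x) ↔ ∃ k : ℤ, c = lam0 ^ k)) →
      LeafNode ⟨U, P, H, 0⟩ → HasTypeIDecay A U → False)
    (hκ : ∀ (I₀ : ℝ≥0∞) (U : ℝ → (EuclideanSpace ℝ (Fin 3)) → (EuclideanSpace ℝ (Fin 3)))
      (P : ℝ → (EuclideanSpace ℝ (Fin 3)) → ℝ)
      (H : ℝ → (EuclideanSpace ℝ (Fin 3)) → (EuclideanSpace ℝ (Fin 3)) →L[ℝ] (EuclideanSpace ℝ (Fin 3)))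
      (lam0 : ℝ) (y : (EuclideanSpace ℝ (Fin 3))),
      (∀ y : (EuclideanSpace ℝ (Fin 3)), DoublyMin I₀ ⟨U, P, H, y⟩) → 1 < lam0 →
      (∀ t < 0, ∀ x, nsRescale lam0 U t x = U t x) →
      (∀ c : ℝ, 0 < c → ((∀ t < 0, ∀ x, nsRescale c U t x = U t x) ↔ ∃ k : ℤ, c = lam0 ^ k)) →
      y ≠ 0 → ¬ RegPt U y → (∀ k : ℤ, ¬ RegPt U ((lam0 ^ k) • y)) → False)
    (hυ : ∀ (M : ℝ) (I₀ : ℝ≥0∞) (U : ℝ → (EuclideanSpace ℝ (Fin 3)) → (EuclideanSpace ℝ (Fin 3)))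
      (P : ℝ → (EuclideanSpace ℝ (Fin 3)) → ℝ)
      (H : ℝ → (EuclideanSpace ℝ (Fin 3)) → (EuclideanSpace ℝ (Fin 3)) →L[ℝ] (EuclideanSpace ℝ (Fin 3))),
      I₀ < ⊤ → levelCrit I₀ ∈ Icc epsL M → minLevel I₀ ≤ I₀ →
      (∀ y : (EuclideanSpace ℝ (Fin 3)), DoublyMin I₀ ⟨U, P, H, y⟩) → ¬ RegPt U 0 →
      IsScalingUniformlyRecurrent U →
      (∀ c : ℝ, 0 < c → (∀ t < 0, ∀ x, nsRescale c U t x = U t x) → c = 1) →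
      ∃ ε : ℝ, 0 < ε ∧ ∃ K : Set (ℝ × (EuclideanSpace ℝ (Fin 3))), IsCompact K ∧
        K ⊆ Iic (0 : ℝ) ×ˢ (univ : Set (EuclideanSpace ℝ (Fin 3))) ∧ ∃ δ : ℝ, 0 < δ ∧
        ∀ σ : ℝ, δ ≤ σ →
          eLpNorm (fun z : ℝ × (EuclideanSpace ℝ (Fin 3)) => nsRescale (Real.exp σ) U z.1 z.2 - U z.1 z.2) 3
            (volume.restrict K) ≤ ENNReal.ofReal ε →
          ∃ c : ℝ, Real.exp (-δ) < c ∧ c < Real.exp δ ∧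
            ∀ᵐ z ∂(volume.restrict (Iio (0 : ℝ) ×ˢ (univ : Set (EuclideanSpace ℝ (Fin 3))))),
              nsRescale (Real.exp σ) U z.1 z.2 = nsRescale c U z.1 z.2) :
    Summit.NavierStokesRegularity.NavierStokesRegularity.Theses.TypeIQuarterGate.ScarEnvelopeTypeI := by
  refine scarEnvelopeTypeI_of_recurrentCellExclusions hτ hκ
    fun M I₀ U P H hI₀ hcrit hmin hdm h0 hfree hrec _ => ?_
  have hT : ABTower (levelCrit I₀) U P H := (hdm 0).1.1.1
  obtain ⟨ε, hε, K, hK, hKH, δ, hδ, hiso⟩ := hυ M I₀ U P H hI₀ hcrit hmin hdm h0 hrec hfree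
  obtain ⟨μ, hμ, hd⟩ := hT.exists_pastDss_of_recurrent_of_orbitIsolated hrec hε hK hKH hδ hiso
  have h1 := hfree μ (one_pos.trans hμ) hd
  linarith

end HullJunction

end Summit.NavierStokesRegularity.NavierStokesRegularity.Cruxes.ScarEnvelopeTypeI.ZoomDictionary
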